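import Literature.NumberTheory.ComplexMultiplication.EllipticUnits.ImaginaryQuadraticMainConjectureLayerDualityMaps
import Literature.NumberTheory.GaloisRepresentations.ContinuousCohomologyConjTwist
import HarnessLib

/-!
# The local twisted coefficients `(μ_{p^k} ⊗ θ′)|_{Γ_{K_v}}` of the class-group row versus the untwisted `μ_{p^k}|_{Γ_{K_v}}` on a subgroup
# where `θ′` is trivial: the comparison morphism, its twist law, the injectivity of its `H²`, and the reduction of the displayed local
# hypothesis of `…ClassGroupRowCokernelLocal` to «`Gal(K̄_v/K_v)` acts trivially on `H²(·, μ_{p^k})`»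

Topic `Literature/NumberTheory/ComplexMultiplication/EllipticUnits` (grouping sub-namespace `JohnsonLeungKings2011.ClassGroupRow`).  Cell `bsd-print-cf2`,
width seat `bsd-line-cf2c-w8` g9.  THEOREMS ONLY (no definition, no named fact, no instance, no `sorry`).

For a continuous `θ′ : Γ_K → ℤ_p^×`, a set `S` of finite places with `N_S ≤ ker (μ_{p^k} ⊗ θ′)` (`hμ`), a finite place `v` and a subgroup
`Λ ≤ Γ_{K_v}` on which `θ′ ∘ res_v` is trivial (`hΛ`): the local coefficient representations
`X_tw := res_{φ_v} (μ_{p^k} ⊗ θ′)^{N_S}` (`φ_v = π ∘ res_v`, the coefficients of the layer localisations of the class-group row) and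
`X_un := μ_{p^k}(K̄)|_{Γ_{K_v}}` (`(mu K (p^k)).restrict (absGaloisRestrict K K_v)`, definitionally the `muAt K (p^k) v = (mu K (p^k)).toLocal v` of
the tree's local invariant maps `localInvariantMapSubgroup`) satisfy:
* `exists_hom_twist_untwist` — an `Λ`-morphism `λ : X_tw|_Λ ⟶ X_un|_Λ` which is the inclusion `(μ⊗θ′)^{N_S} ⊆ μ` on carriers, with the TWIST LAW
  `λ(g·w) = (θ′(res_v g) mod p^k) · (g·λ w)` for every `g ∈ Γ_{K_v}`, and an `Λ`-morphism `X_un|_Λ ⟶ X_tw|_Λ` inverse to it on carriers;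
* `cohomologyMap_injective_of_leftInverse` — `H²(λ)` is injective (generic: a carrier-level left inverse);
* **`conjMap_two_eq_zsmul_of_untwisted_trivial`** — if `g ∈ Γ_{K_v}` acts trivially on `H²(Λ, X_un)` (the local class field theory input:
  `Gal(K̄_v/K_v)` acts trivially on `Br(L)[p^k]`), then `conj_g c = (θ′(res_v g) mod p^k) · c` on `H²(Λ, X_tw)` — the `(LI-conj)` clause of
  `JLKDescent.classGroupRow_hfcoker`'s `hplaces` (with `u := (θ′(res_v g) mod p^k).val`, any `e`).

HONEST FRAMING: bookkeeping; the class field theory input stays displayed; no summit statement is proved by this seat.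

## References
* J. Johnson-Leung, G. Kings (2011), §1.2 Def. 1.1, §3.3 (5), §5.4 Lemma 5.8. [JohnsonLeungKings2011]
* J.-P. Serre, *Local Fields* (1979), VII §5 Prop. 3. [SerreLocalFields1979]
-/

noncomputable section

open scoped NumberField
open CategoryTheory Function Field IsDedekindDomain NumberField
open Literature.NumberTheory.GaloisRepresentations
open Literature.NumberTheory.GaloisRepresentations.DiscreteGaloisModule
open Literature.NumberTheory.EllipticCurves

namespace Literature.NumberTheory.ComplexMultiplication.EllipticUnits.JohnsonLeungKings2011.ClassGroupRow

open Literature.NumberTheory.GaloisCohomology.ShaLayer (locHom)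

/-! ## §1 Generic: a carrier-level left inverse makes `H²` of a morphism injective -/

section Generic

universe u v

variable {R : Type u} [CommRing R] [TopologicalSpace R]
variable {G : Type v} [Group G] [TopologicalSpace G] [IsTopologicalGroup G] [LocallyCompactSpace G]

/-- **`H²(λ)` is injective when `λ` has a left inverse on carriers** (`μ ∘ λ = id` for some morphism `μ`): `H²(μ) ∘ H²(λ) = H²(id) = id`.
[cite: SerreLocalFields1979, VII §5] -/
theorem cohomologyMap_injective_of_leftInverse {A B : TopRep.{v} R G} (lam : A ⟶ B) (mu : B ⟶ A)
    (h : ∀ a, mu.hom (lam.hom a) = a) : Function.Injective (cohomologyMap lam 2) := by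
  intro y y' hyy'
  have key : ∀ z : continuousCohomology 2 A, cohomologyMap mu 2 (cohomologyMap lam 2 z) = z := fun z => by
    have h1 := map_comp_apply_of (ContinuousMonoidHom.id G) (ContinuousMonoidHom.id G) (ContinuousMonoidHom.id G) (fun _ => rfl)
      (resIdHom lam) (resIdHom mu) (TopRep.ofHom ⟨ContinuousLinearMap.id R A, fun _ => rfl⟩) (fun a => (h a).symm) 2 z
    rw [map_id_id_two] at h1
    exact h1.symm
  rw [← key y, ← key y', hyy']

end Generic

/-! ## §2 The comparison morphisms between the twisted and the untwisted local coefficients -/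

section Local

variable {K : Type} [Field K] [NumberField K] (p : ℕ) [Fact p.Prime] (θ' : absoluteGaloisGroup K →ₜ* ℤ_[p]ˣ)
  (S : Set (HeightOneSpectrum (𝓞 K))) (k : ℕ) (v : HeightOneSpectrum (𝓞 K))
  (Λ : Subgroup (absoluteGaloisGroup (v.adicCompletion K)))

omit [NumberField K] in
/-- The twisted action in the `zsmul` form: `σ ·_θ′ ζ = (θ′(σ) mod p^k).val • (σ ζ)`. [cite: JohnsonLeungKings2011, §1.2 Def. 1.1 (arXiv p0005:L1–30)] -/
theorem muTwist_apply_eq_val_zsmul (σ : absoluteGaloisGroup K) (ζ : MuCarrier K (p ^ k)) :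
    muTwist p θ' k σ ζ = ((charModPow p θ' k σ).val : ℤ) • mu K (p ^ k) σ ζ := rfl

/-- **The comparison morphism `λ : X_tw|_Λ ⟶ X_un|_Λ`** (inclusion of carriers), an `Λ`-morphism when `θ′ ∘ res_v` is trivial on `Λ`, together with
its TWIST LAW for every `g ∈ Γ_{K_v}`. [cite: JohnsonLeungKings2011, §3.3 display after (5) (arXiv p0010:L63–68)] [cite: SerreLocalFields1979, VII §5] -/
theorem exists_hom_twist_untwist (hΛ : ∀ s ∈ Λ, θ' (absGaloisRestrict K (v.adicCompletion K) s) = 1) :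
    ∃ lam : subgroupRep (TopRep.res (locHom (S := S) v : absoluteGaloisGroup (v.adicCompletion K) →* GaloisGroupUnramifiedOutside K S)
          ((muTwist p θ' k).quotientInvariants (ramificationSubgroup K S)).toTopRep) Λ ⟶
        subgroupRep ((mu K (p ^ k)).restrict (absGaloisRestrict K (v.adicCompletion K))).toTopRep Λ,
      (∀ w, lam.hom w = (w : MuCarrier K (p ^ k))) ∧
      ∀ (g : absoluteGaloisGroup (v.adicCompletion K)) (w),
        lam.hom ((TopRep.res (locHom (S := S) v : absoluteGaloisGroup (v.adicCompletion K) →* GaloisGroupUnramifiedOutside K S)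
          ((muTwist p θ' k).quotientInvariants (ramificationSubgroup K S)).toTopRep).ρ g w) =
          ((charModPow p θ' k (absGaloisRestrict K (v.adicCompletion K) g)).val : ℤ) •
            ((mu K (p ^ k)).restrict (absGaloisRestrict K (v.adicCompletion K))).toTopRep.ρ g (lam.hom w) := by
  refine ⟨TopRep.ofHom
    { toLinearMap := ((muTwist p θ' k).invariantsOf (ramificationSubgroup K S)).subtype.toAddMonoidHom.toIntLinearMap
      cont := continuous_of_discreteTopology
      isIntertwining' := fun s => by
        ext w
        change ((muTwist p θ' k) (absGaloisRestrict K (v.adicCompletion K) s.1) (w : MuCarrier K (p ^ k))) =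
          mu K (p ^ k) (absGaloisRestrict K (v.adicCompletion K) s.1) (w : MuCarrier K (p ^ k))
        exact muTwist_apply_of_apply_eq_one p θ' k (hΛ s.1 s.2) _ }, fun _ => rfl, fun g w => ?_⟩
  exact muTwist_apply_eq_val_zsmul p θ' k _ _

/-- **The inverse comparison `X_un|_Λ ⟶ X_tw|_Λ`** (the identity of carriers into the invariants, all of `μ` being `N_S`-invariant under `hμ`).
[cite: JohnsonLeungKings2011, §3.3 display after (5) (arXiv p0010:L63–68)] -/
theorem exists_hom_untwist_twist (hμ : ramificationSubgroup K S ≤ ContinuousRep.ker (muTwist p θ' k))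
    (hΛ : ∀ s ∈ Λ, θ' (absGaloisRestrict K (v.adicCompletion K) s) = 1) :
    ∃ inv : subgroupRep ((mu K (p ^ k)).restrict (absGaloisRestrict K (v.adicCompletion K))).toTopRep Λ ⟶
        subgroupRep (TopRep.res (locHom (S := S) v : absoluteGaloisGroup (v.adicCompletion K) →* GaloisGroupUnramifiedOutside K S)
          ((muTwist p θ' k).quotientInvariants (ramificationSubgroup K S)).toTopRep) Λ,
      ∀ x, (inv.hom x : MuCarrier K (p ^ k)) = x := by
  have hmem : ∀ x : MuCarrier K (p ^ k), x ∈ (muTwist p θ' k).invariantsOf (ramificationSubgroup K S) := fun x =>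
    Literature.NumberTheory.GaloisCohomology.ShaLayer.mem_invariants_of_le_ker S (muTwist p θ' k) hμ x
  refine ⟨TopRep.ofHom
    { toLinearMap := (LinearMap.codRestrict ((muTwist p θ' k).invariantsOf (ramificationSubgroup K S)) LinearMap.id hmem)
      cont := continuous_of_discreteTopology
      isIntertwining' := fun s => by
        ext x
        change mu K (p ^ k) (absGaloisRestrict K (v.adicCompletion K) s.1) x =
          (muTwist p θ' k) (absGaloisRestrict K (v.adicCompletion K) s.1) x
        exact (muTwist_apply_of_apply_eq_one p θ' k (hΛ s.1 s.2) _).symm }, fun _ => rfl⟩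

/-- **REDUCTION OF (LI-conj) TO THE UNTWISTED TRIVIALITY.**  If `θ′ ∘ res_v` is trivial on the normal subgroup `Λ ≤ Γ_{K_v}`, `N_S ≤ ker(μ_{p^k} ⊗ θ′)`,
and `g ∈ Γ_{K_v}` acts TRIVIALLY on `H²(Λ, μ_{p^k}|)` (the untwisted local coefficients of `localInvariantMapSubgroup`), then `g` acts on
`H²(Λ, res_{φ_v}(μ_{p^k} ⊗ θ′)^{N_S})` as the scalar `(θ′(res_v g) mod p^k).val`. [cite: JohnsonLeungKings2011, §5.4 Lemma 5.8 (proof)] [cite: SerreLocalFields1979, VII §5 Prop. 3] -/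
theorem conjMap_two_eq_zsmul_of_untwisted_trivial [Λ.Normal] [LocallyCompactSpace Λ]
    [LocallyCompactSpace (absoluteGaloisGroup (v.adicCompletion K))]
    (hμ : ramificationSubgroup K S ≤ ContinuousRep.ker (muTwist p θ' k))
    (hΛ : ∀ s ∈ Λ, θ' (absGaloisRestrict K (v.adicCompletion K) s) = 1) (g : absoluteGaloisGroup (v.adicCompletion K))
    (hLI : ∀ z : continuousCohomology 2 (subgroupRep ((mu K (p ^ k)).restrict (absGaloisRestrict K (v.adicCompletion K))).toTopRep Λ),
      conjMap ((mu K (p ^ k)).restrict (absGaloisRestrict K (v.adicCompletion K))).toTopRep Λ g 2 z = z)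
    (c : continuousCohomology 2 (subgroupRep (TopRep.res (locHom (S := S) v : absoluteGaloisGroup (v.adicCompletion K) →*
        GaloisGroupUnramifiedOutside K S) ((muTwist p θ' k).quotientInvariants (ramificationSubgroup K S)).toTopRep) Λ)) :
    conjMap (TopRep.res (locHom (S := S) v : absoluteGaloisGroup (v.adicCompletion K) →* GaloisGroupUnramifiedOutside K S)
        ((muTwist p θ' k).quotientInvariants (ramificationSubgroup K S)).toTopRep) Λ g 2 c =
      ((charModPow p θ' k (absGaloisRestrict K (v.adicCompletion K) g)).val : ℤ) • c := by
  obtain ⟨lam, hlam, htwist⟩ := exists_hom_twist_untwist p θ' S k v Λ hΛ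
  obtain ⟨inv, hinv⟩ := exists_hom_untwist_twist p θ' S k v Λ hμ hΛ
  refine conjMap_two_eq_zsmul_of_twist _ _ Λ lam g _ (htwist g) ?_ hLI c
  exact cohomologyMap_injective_of_leftInverse lam inv fun a => Subtype.ext ((hinv _).trans (hlam a))

end Local

end Literature.NumberTheory.ComplexMultiplication.EllipticUnits.JohnsonLeungKings2011.ClassGroupRow

end
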